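import Mathlib
import HarnessLib

/-!
# Lagrange interpolation at the extrema of `T_n` and the Duffin–Schaeffer node inequality
(Rivlin 1974, Ex. 1.3.4 (1.60), Ex. 1.5.7 (1.98)–(1.99), Ex. 1.5.8 (1.100))

T. J. Rivlin, *The Chebyshev Polynomials* (Wiley, 1974) [Rivlin1974], §1.3 "Polynomial
interpolation at the zeros and extrema" and Exercises 1.3 / 1.5. Notation of the text:
`I = [-1, 1]`, `T_n(x) = cos nθ` (`x = cos θ`), `ξ_j^{(n)} = cos((2j-1)π/(2n))` the zeros and
`η_j^{(n)} = cos(jπ/n)`, `j = 0, …, n`, the extrema of `T_n` on `I`; `U` is the array of nodes whose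
`(n+1)`-st row is `η_0, …, η_n`, `l_j` the fundamental (Lagrange) polynomials (1.25) of a row of
nodes and `L_n(f, U; x) = Σ_j f(η_j) l_j(x)` (1.27) the interpolating polynomial in `𝒫_n`.

* Ex. 1.3.4 (1.60) and its simplification Ex. 1.5.7 (1.98)–(1.99):
  `L_n(f, U; x) = ((1 - x²) T_n'(x) / n²) Σ''_{j=0}^{n} (-1)^{j+1} f(η_j) / (x - η_j)`, where
  `Σ''` is the "trapezoidal" sum `Σ''_{j=0}^{n} u_j = u_0/2 + u_1 + ⋯ + u_{n-1} + u_n/2` (1.99).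
* Ex. 1.5.8 (Duffin and Schaeffer, *A refinement of an inequality of the brothers Markoff*,
  Trans. AMS 50 (1941)): if `p ∈ 𝒫_n` and `|p(η_j^{(n)})| ≤ 1`, `j = 0, …, n`, then
  `|p'(ξ_j^{(n)})| ≤ n (1 - (ξ_j^{(n)})²)^{-1/2} = |T_n'(ξ_j^{(n)})|`, `j = 1, …, n` (1.100);
  Rivlin's hint: `p'(ξ_j) = L_n'(p, U; ξ_j)`, hence `T_n'(ξ_j) = L_n'(T_n, U; ξ_j)`.

FORMALISATION. Everything is phrased over Mathlib's `Lagrange.basis` / `Lagrange.interpolate` /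
`Lagrange.nodal` / `Lagrange.nodalWeight` with index set `Finset.range (n+1)` and Mathlib's node
map `Polynomial.Chebyshev.node n j = cos(jπ/n)` (Mathlib's `Chebyshev.Extremal` file supplies
`node_eq_one`, `node_eq_neg_one`, `node_mem_Icc`, `eval_T_real_node`, `strictAntiOn_node` and the
leading-coefficient extremal property, none of which is restated here); the trapezoidal sum
`Σ'' u_j` is written `Σ_j u_j / trapezoidWeight n j` with `trapezoidWeight n j = 2` for
`j ∈ {0, n}` and `1` otherwise.

* Nodes: `injOn_node`, `T_eval_node` (`T_n(η_j) = (-1)^j`, all `j`),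
  `derivative_T_eval_node_eq_zero` (`T_n'(η_j) = 0`, `0 < j < n`),
  `derivative_T_eval_neg_one_nat`.
* The nodal polynomial `W(x) = Π_{j=0}^{n} (x - η_j)` is `(x² - 1) T_n'(x) / (n 2^{n-1})`
  (`C_mul_extremaNodal`, `extremaNodal_eval`); by the differential equation of `T_n` (Mathlib
  `one_sub_X_sq_mul_derivative_derivative_T_eq_poly_in_T`),
  `((x² - 1) T_n'(x))' = x T_n'(x) + n² T_n(x)` (`derivative_X_sq_sub_one_mul_derivative_T`), whose
  value at `η_j` is `(-1)^j n² · trapezoidWeight n j` (`eval_X_mul_derivative_T_add_node`); hence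
  `W'(η_j) = (-1)^j n · trapezoidWeight n j / 2^{n-1}` and the barycentric weights
  `nodalWeight_node_eq : w_j = (-1)^j 2^{n-1} / (n · trapezoidWeight n j)`.
* (1.98): `eval_basis_node`
  (`l_j(x) = (-1)^j (x² - 1) T_n'(x) / (n² trapezoidWeight n j (x - η_j))` off the nodes),
  `eval_interpolate_node_eq` (the displayed formula for `L_n(f, U; x)`),
  `eq_interpolate_node` / `eval_eq_sum_node` (every `p ∈ 𝒫_n` is its own interpolant).
* At a zero `ξ` of `T_n` (hypothesis `(T ℝ n).eval ξ = 0`, so any `ξ_j^{(n)}`): `|ξ| < 1`,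
  `(1 - ξ²) T_n'(ξ)² = n²` (`one_sub_sq_mul_derivative_T_eval_sq`), `|T_n'(ξ)| = n / √(1 - ξ²)`
  (`abs_derivative_T_eval_eq_of_T_eval_eq_zero`), the differentiated fundamental polynomials
  `l_j'(ξ) = (-1)^j T_n'(ξ) (1 - ξ η_j) / (n² trapezoidWeight n j (ξ - η_j)²)`
  (`derivative_basis_eval_of_T_eval_eq_zero` — note the sign `(-1)^j · sgn T_n'(ξ)`, uniform in
  `j`), the resulting formula
  `p'(ξ) = (T_n'(ξ)/n²) Σ_j (-1)^j p(η_j)(1 - ξη_j) / (trapezoidWeight n j (ξ - η_j)²)` for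
  `p ∈ 𝒫_n` (`derivative_eval_eq_sum_of_T_eval_eq_zero`, = `L_n'(p, U; ξ)`), and, taking `p = T_n`,
  the identity `Σ_j (1 - ξη_j) / (trapezoidWeight n j (ξ - η_j)²) = n²`
  (`sum_node_weights_eq_sq`).
* (1.100) DUFFIN–SCHAEFFER: `duffinSchaeffer_abs_derivative_eval_le`
  (`|p'(ξ)| ≤ |T_n'(ξ)|`), `duffinSchaeffer_abs_derivative_eval_le_div_sqrt`
  (`|p'(ξ)| ≤ n / √(1 - ξ²)`) and the node-indexed form `duffinSchaeffer_at_cos`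
  (`ξ = cos((2j+1)π/(2n))`, 0-based).

Not formalised here: the equality statement of Ex. 1.5.8 (`p = ± T_n`), and Ex. 1.5.9–1.5.11
(higher derivatives; Rogosinski).
-/

namespace Literature.Analysis.Approximation.ChebyshevExtremaInterpolation

open Polynomial Polynomial.Chebyshev Real Finset

/-! ## The extrema `η_j = cos(jπ/n)` as interpolation nodes -/

/-- Rivlin's `η_j^{(n)} = cos(jπ/n)`, `j = 0, …, n` — the extrema of `T_n` on `[-1, 1]`, the
`(n+1)`-st row of the node array `U` — is Mathlib's `Polynomial.Chebyshev.node n j`; we use that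
definition and its lemmas (`node_eq_one`, `node_eq_neg_one`, `node_mem_Icc`, `eval_T_real_node`,
`strictAntiOn_node`) throughout. [cite: Rivlin1974, Sect. 1.2 and Ex. 1.3.4] -/
theorem node_eq_cos (n j : ℕ) : node n j = Real.cos (j * π / n) := rfl

/-- `|η_j| ≤ 1`. [cite: Rivlin1974, Sect. 1.2] -/
theorem abs_node_le_one (n j : ℕ) : |node n j| ≤ 1 :=
  abs_le.2 ⟨(node_mem_Icc (n := n) (i := j)).1, (node_mem_Icc (n := n) (i := j)).2⟩

/-- The `n + 1` nodes `η_0, …, η_n` are distinct (from Mathlib's `strictAntiOn_node`), in the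
`Set.InjOn` form consumed by the `Lagrange` API. [cite: Rivlin1974, Sect. 1.2 and Ex. 1.3.4] -/
theorem injOn_node (n : ℕ) : Set.InjOn (node n) (range (n + 1) : Finset ℕ) :=
  (strictAntiOn_node n).injOn

/-- The node map `Fin (n+1) → ℝ`, `j ↦ η_j`, is injective. [cite: Rivlin1974, Ex. 1.3.4] -/
theorem node_injective_fin {n : ℕ} :
    Function.Injective (fun j : Fin (n + 1) => node n j) := by
  intro i j h
  exact Fin.ext (injOn_node n (by simpa using i.2) (by simpa using j.2) h)

/-- `T_n(η_j) = (-1)^j` for EVERY `j : ℕ` once `n ≥ 1` (Mathlib's `eval_T_real_node` is the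
`j ≤ n` form, with no hypothesis on `n`). [cite: Rivlin1974, Sect. 1.2] -/
theorem T_eval_node {n : ℕ} (hn : n ≠ 0) (j : ℕ) :
    (T ℝ n).eval (node n j) = (-1) ^ j := by
  have := eval_T_real_cos_int_mul_pi_div (k := j) hn
  rw [node, this, Int.cast_negOnePow_natCast]

/-- `T_n'(η_j) = 0` at the interior extrema `0 < j < n`. [cite: Rivlin1974, Sect. 1.2] -/
theorem derivative_T_eval_node_eq_zero {n j : ℕ} (h0 : 0 < j) (hj : j < n) :
    (derivative (T ℝ n)).eval (node n j) = 0 := by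
  have hn : n ≠ 0 := by omega
  have hn' : (0 : ℝ) < n := by exact_mod_cast Nat.pos_of_ne_zero hn
  rw [T_derivative_eq_U, eval_mul, eval_intCast, node]
  have hs : Real.sin ((j : ℝ) * π / n) ≠ 0 := by
    apply (Real.sin_pos_of_pos_of_lt_pi _ _).ne'
    · positivity
    · rw [div_lt_iff₀ hn']
      have : (j : ℝ) < n := by exact_mod_cast hj
      nlinarith [pi_pos]
  have hU := U_real_cos ((j : ℝ) * π / n) ((n : ℤ) - 1)
  have : (((n : ℤ) - 1 : ℤ) : ℝ) + 1 = n := by push_cast; ring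
  rw [this, show (n : ℝ) * ((j : ℝ) * π / n) = (j : ℝ) * π by field_simp] at hU
  rw [Real.sin_nat_mul_pi] at hU
  have hU0 : (U ℝ ((n : ℤ) - 1)).eval (Real.cos ((j : ℝ) * π / n)) = 0 := by
    rcases mul_eq_zero.1 hU with h | h
    · exact h
    · exact absurd h hs
  rw [hU0, mul_zero]

/-- `T_n'(1) = n²` (Mathlib `derivative_T_eval_one`, natural-number index).
[cite: Rivlin1974, Sect. 1.2 and (1.97)] -/
theorem derivative_T_eval_one_nat (n : ℕ) : (derivative (T ℝ n)).eval 1 = (n : ℝ) ^ 2 := by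
  have := derivative_T_eval_one (R := ℝ) (n : ℤ)
  simpa using this

/-- `T_n'(-1) = (-1)^{n+1} n²`. [cite: Rivlin1974, Sect. 1.2] -/
theorem derivative_T_eval_neg_one_nat (n : ℕ) :
    (derivative (T ℝ n)).eval (-1) = (-1) ^ (n + 1) * (n : ℝ) ^ 2 := by
  rcases Nat.eq_zero_or_pos n with rfl | hn
  · simp
  rw [T_derivative_eq_U, eval_mul, eval_intCast, U_eval_neg_one, Int.coe_negOnePow]
  have h1 : (((n : ℤ) - 1).natAbs) = n - 1 := by omega
  rw [h1]
  obtain ⟨m, rfl⟩ := Nat.exists_eq_succ_of_ne_zero hn.ne'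
  push_cast
  simp [pow_succ]
  ring

/-- From the differential equation `(1 - x²) T_n'' - x T_n' + n² T_n = 0` (1.92):
`((x² - 1) T_n'(x))' = x T_n'(x) + n² T_n(x)`. [cite: Rivlin1974, (1.92) and Ex. 1.3.4] -/
theorem derivative_X_sq_sub_one_mul_derivative_T (n : ℕ) :
    derivative ((X ^ 2 - 1 : ℝ[X]) * derivative (T ℝ n)) =
      X * derivative (T ℝ n) + ((n : ℝ[X]) ^ 2) * T ℝ n := by
  have h := one_sub_X_sq_mul_derivative_derivative_T_eq_poly_in_T (R := ℝ) (n : ℤ)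
  rw [Function.iterate_succ, Function.iterate_one, Function.comp_apply] at h
  rw [derivative_mul]
  simp only [derivative_sub, derivative_X_pow, Nat.cast_ofNat, Polynomial.C_ofNat, derivative_one,
    sub_zero]
  linear_combination (-1 : ℝ[X]) * h

/-- The weights of the "trapezoidal" sum (1.99):
`Σ''_{j=0}^{n} u_j = Σ_j u_j / trapezoidWeight n j`,
`trapezoidWeight n j = 2` for `j = 0` and `j = n`, `= 1` otherwise. [cite: Rivlin1974, (1.99)] -/
noncomputable def trapezoidWeight (n j : ℕ) : ℝ := if j = 0 ∨ j = n then 2 else 1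

/-- `trapezoidWeight n j > 0`. [cite: Rivlin1974, (1.99)] -/
theorem trapezoidWeight_pos (n j : ℕ) : 0 < trapezoidWeight n j := by
  unfold trapezoidWeight; split_ifs <;> norm_num

/-- `trapezoidWeight n j ≥ 1`. [cite: Rivlin1974, (1.99)] -/
theorem one_le_trapezoidWeight (n j : ℕ) : 1 ≤ trapezoidWeight n j := by
  unfold trapezoidWeight; split_ifs <;> norm_num

/-- `η_j T_n'(η_j) + n² T_n(η_j) = (-1)^j n² · trapezoidWeight n j` (`= 2 (-1)^j n²` at the end
points, `(-1)^j n²` at the interior extrema). [cite: Rivlin1974, Ex. 1.3.4 (1.60)] -/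
theorem eval_X_mul_derivative_T_add_node {n j : ℕ} (hn : n ≠ 0) (hj : j ≤ n) :
    (X * derivative (T ℝ n) + ((n : ℝ[X]) ^ 2) * T ℝ n).eval (node n j) =
      (-1) ^ j * (n : ℝ) ^ 2 * trapezoidWeight n j := by
  simp only [eval_add, eval_mul, eval_X, eval_pow, eval_natCast, T_eval_node hn]
  unfold trapezoidWeight
  rcases Nat.eq_zero_or_pos j with rfl | hj0
  · simp [node_eq_one, derivative_T_eval_one_nat]; ring
  rcases eq_or_lt_of_le hj with rfl | hjn
  · simp [node_eq_neg_one hn, derivative_T_eval_neg_one_nat, hn]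
    ring
  · rw [derivative_T_eval_node_eq_zero hj0 hjn, if_neg (by omega)]
    ring

/-! ## The nodal polynomial `W = Π (x - η_j) = (x² - 1) T_n'(x) / (n 2^{n-1})` -/

/-- `W(x) = Π_{j=0}^{n} (x - η_j)` (Mathlib `Lagrange.nodal`). [cite: Rivlin1974, Ex. 1.3.4] -/
noncomputable def extremaNodal (n : ℕ) : ℝ[X] := Lagrange.nodal (range (n + 1)) (node n)

/-- `W(η_j) = 0`. [cite: Rivlin1974, Ex. 1.3.4] -/
theorem extremaNodal_eval_node {n j : ℕ} (hj : j ≤ n) : (extremaNodal n).eval (node n j) = 0 :=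
  Lagrange.eval_nodal_at_node (mem_range.2 (Nat.lt_succ_of_le hj))

/-- `deg W = n + 1`. [cite: Rivlin1974, Ex. 1.3.4] -/
theorem natDegree_extremaNodal (n : ℕ) : (extremaNodal n).natDegree = n + 1 := by
  simp [extremaNodal, Lagrange.natDegree_nodal]

/-- `W` is monic. [cite: Rivlin1974, Ex. 1.3.4] -/
theorem monic_extremaNodal (n : ℕ) : (extremaNodal n).Monic := by
  unfold extremaNodal
  rw [Lagrange.nodal_eq]
  exact monic_prod_of_monic _ _ (fun i _ => monic_X_sub_C _)

/-- `(x² - 1) T_n'(x)` vanishes at every `η_j`. [cite: Rivlin1974, Ex. 1.3.4] -/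
theorem eval_X_sq_sub_one_mul_derivative_T_node {n j : ℕ} (hn : n ≠ 0) (hj : j ≤ n) :
    ((X ^ 2 - 1 : ℝ[X]) * derivative (T ℝ n)).eval (node n j) = 0 := by
  rcases Nat.eq_zero_or_pos j with rfl | hj0
  · simp [node_eq_one]
  rcases eq_or_lt_of_le hj with rfl | hjn
  · simp [node_eq_neg_one hn]
  · simp [eval_mul, derivative_T_eval_node_eq_zero hj0 hjn]

/-- `deg ((x² - 1) T_n') ≤ n + 1`. [cite: Rivlin1974, Ex. 1.3.4] -/
theorem natDegree_X_sq_sub_one_mul_derivative_T_le (n : ℕ) :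
    ((X ^ 2 - 1 : ℝ[X]) * derivative (T ℝ n)).natDegree ≤ n + 1 := by
  rcases Nat.eq_zero_or_pos n with rfl | hn
  · simp
  have h1 : (X ^ 2 - 1 : ℝ[X]).natDegree ≤ 2 :=
    (natDegree_sub_le _ _).trans (by simp)
  have h2 : (derivative (T ℝ n)).natDegree ≤ n - 1 := by
    have := natDegree_derivative_le (T ℝ n)
    rwa [natDegree_T, Int.natAbs_natCast] at this
  exact natDegree_mul_le.trans (by omega)

/-- The coefficient of `x^{n+1}` in `(x² - 1) T_n'(x)` is `n 2^{n-1}`.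
[cite: Rivlin1974, Ex. 1.3.4] -/
theorem coeff_X_sq_sub_one_mul_derivative_T {n : ℕ} (hn : n ≠ 0) :
    ((X ^ 2 - 1 : ℝ[X]) * derivative (T ℝ n)).coeff (n + 1) = (n : ℝ) * 2 ^ (n - 1) := by
  have h2 : (derivative (T ℝ n)).natDegree ≤ n - 1 := by
    have := natDegree_derivative_le (T ℝ n)
    rwa [natDegree_T, Int.natAbs_natCast] at this
  rw [sub_mul, one_mul, coeff_sub]
  have e1 : n + 1 = (n - 1) + 2 := by omega
  rw [e1, coeff_X_pow_mul, coeff_derivative]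
  have hc0 : (derivative (T ℝ n)).coeff (n - 1 + 2) = 0 :=
    coeff_eq_zero_of_natDegree_lt (by omega)
  rw [hc0, sub_zero, show n - 1 + 1 = n by omega]
  have hT : (T ℝ n).coeff n = 2 ^ (n - 1) := by
    have h := leadingCoeff_T ℝ (n : ℤ)
    rwa [leadingCoeff, natDegree_T, Int.natAbs_natCast] at h
  rw [hT, show ((n - 1 : ℕ) : ℝ) + 1 = n by
    rw [Nat.cast_sub (Nat.one_le_iff_ne_zero.2 hn)]; push_cast; ring]
  ring

/-- IDENTIFICATION OF THE NODAL POLYNOMIAL: `n 2^{n-1} · Π_{j=0}^{n} (x - η_j) = (x² - 1) T_n'(x)`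
(both sides have degree `n + 1`, the same leading coefficient and vanish at the `n + 1` distinct
`η_j`). [cite: Rivlin1974, Ex. 1.3.4 (1.60)] -/
theorem C_mul_extremaNodal {n : ℕ} (hn : n ≠ 0) :
    C ((n : ℝ) * 2 ^ (n - 1)) * extremaNodal n = (X ^ 2 - 1 : ℝ[X]) * derivative (T ℝ n) := by
  symm
  rw [← sub_eq_zero]
  set Q := (X ^ 2 - 1 : ℝ[X]) * derivative (T ℝ n) - C ((n : ℝ) * 2 ^ (n - 1)) * extremaNodal n
    with hQ
  have hQ1 : Q.natDegree ≤ n + 1 := by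
    refine (natDegree_sub_le _ _).trans (max_le (natDegree_X_sq_sub_one_mul_derivative_T_le n) ?_)
    exact (natDegree_C_mul_le _ _).trans (natDegree_extremaNodal n).le
  have hQ2 : Q.coeff (n + 1) = 0 := by
    rw [hQ, coeff_sub, coeff_C_mul, coeff_X_sq_sub_one_mul_derivative_T hn]
    have : (extremaNodal n).coeff (n + 1) = 1 := by
      have h := monic_extremaNodal n
      rwa [Monic, leadingCoeff, natDegree_extremaNodal] at h
    rw [this, mul_one, sub_self]
  apply eq_zero_of_natDegree_lt_card_of_eval_eq_zero Q (node_injective_fin (n := n))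
  · intro i
    have hi : (i : ℕ) ≤ n := Nat.lt_succ_iff.1 i.2
    rw [hQ, eval_sub, eval_X_sq_sub_one_mul_derivative_T_node hn hi, eval_mul, eval_C,
      extremaNodal_eval_node hi, mul_zero, sub_zero]
  · rw [Fintype.card_fin]
    rcases eq_or_ne Q 0 with h0 | h0
    · simp [h0]
    · have hne : Q.natDegree ≠ n + 1 := by
        intro heq
        have hl := leadingCoeff_ne_zero.2 h0
        rw [leadingCoeff, heq, hQ2] at hl
        exact hl rfl
      omega

/-- `W = (x² - 1) T_n'(x) / (n 2^{n-1})` as polynomials. [cite: Rivlin1974, Ex. 1.3.4 (1.60)] -/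
theorem extremaNodal_eq {n : ℕ} (hn : n ≠ 0) :
    extremaNodal n = C (((n : ℝ) * 2 ^ (n - 1))⁻¹) * ((X ^ 2 - 1 : ℝ[X]) * derivative (T ℝ n)) := by
  have hc : (n : ℝ) * 2 ^ (n - 1) ≠ 0 := by positivity
  rw [← C_mul_extremaNodal hn, ← mul_assoc, ← Polynomial.C_mul, inv_mul_cancel₀ hc, Polynomial.C_1,
    one_mul]

/-- `W(x) = (x² - 1) T_n'(x) / (n 2^{n-1})`. [cite: Rivlin1974, Ex. 1.3.4 (1.60)] -/
theorem extremaNodal_eval {n : ℕ} (hn : n ≠ 0) (x : ℝ) :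
    (extremaNodal n).eval x =
      (x ^ 2 - 1) * (derivative (T ℝ n)).eval x / ((n : ℝ) * 2 ^ (n - 1)) := by
  rw [extremaNodal_eq hn]
  simp [eval_mul]
  ring

/-- `W' = (x T_n'(x) + n² T_n(x)) / (n 2^{n-1})` as polynomials.
[cite: Rivlin1974, Ex. 1.3.4 (1.60)] -/
theorem derivative_extremaNodal_eq {n : ℕ} (hn : n ≠ 0) :
    derivative (extremaNodal n) =
      C (((n : ℝ) * 2 ^ (n - 1))⁻¹) * (X * derivative (T ℝ n) + ((n : ℝ[X]) ^ 2) * T ℝ n) := by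
  rw [extremaNodal_eq hn, derivative_C_mul, derivative_X_sq_sub_one_mul_derivative_T]

/-- `W'(η_j) = (-1)^j n · trapezoidWeight n j / 2^{n-1}`. [cite: Rivlin1974, Ex. 1.3.4 (1.60)] -/
theorem derivative_extremaNodal_eval_node {n j : ℕ} (hn : n ≠ 0) (hj : j ≤ n) :
    (derivative (extremaNodal n)).eval (node n j) =
      (-1) ^ j * n * trapezoidWeight n j / 2 ^ (n - 1) := by
  rw [derivative_extremaNodal_eq hn, eval_mul, eval_C, eval_X_mul_derivative_T_add_node hn hj]
  have hn' : (n : ℝ) ≠ 0 := by exact_mod_cast hn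
  field_simp

/-- The barycentric weights of the extrema:
`w_j = 1 / W'(η_j) = (-1)^j 2^{n-1} / (n · trapezoidWeight n j)`
— the factor `1 / trapezoidWeight` is the halving of the end terms in `Σ''` (1.99).
[cite: Rivlin1974, Ex. 1.3.4 (1.60) and Ex. 1.5.7 (1.98)-(1.99)] -/
theorem nodalWeight_node_eq {n j : ℕ} (hn : n ≠ 0) (hj : j ≤ n) :
    Lagrange.nodalWeight (range (n + 1)) (node n) j =
      (-1) ^ j * 2 ^ (n - 1) / ((n : ℝ) * trapezoidWeight n j) := by
  rw [Lagrange.nodalWeight_eq_eval_derivative_nodal (mem_range.2 (Nat.lt_succ_of_le hj)),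
    show Lagrange.nodal (range (n + 1)) (node n) = extremaNodal n from rfl,
    derivative_extremaNodal_eval_node hn hj]
  have hn' : (n : ℝ) ≠ 0 := by exact_mod_cast hn
  have hd := (trapezoidWeight_pos n j).ne'
  rcases neg_one_pow_eq_or ℝ j with h | h <;> rw [h] <;> field_simp

/-! ## (1.98): the fundamental polynomials and `L_n(f, U; x)` -/

/-- (1.98) for the fundamental polynomials: off the nodes,
`l_j(x) = (-1)^j (x² - 1) T_n'(x) / (n² · trapezoidWeight n j · (x - η_j))`
`= ((1 - x²) T_n'(x)/n²) · (-1)^{j+1} / (trapezoidWeight n j (x - η_j))`.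
[cite: Rivlin1974, Ex. 1.3.4 (1.60) and Ex. 1.5.7 (1.98)] -/
theorem eval_basis_node {n j : ℕ} (hn : n ≠ 0) (hj : j ≤ n) {x : ℝ} (hx : x ≠ node n j) :
    (Lagrange.basis (range (n + 1)) (node n) j).eval x =
      (-1) ^ j * ((x ^ 2 - 1) * (derivative (T ℝ n)).eval x) /
        ((n : ℝ) ^ 2 * trapezoidWeight n j * (x - node n j)) := by
  rw [Lagrange.eval_basis_not_at_node (mem_range.2 (Nat.lt_succ_of_le hj)) hx,
    show Lagrange.nodal (range (n + 1)) (node n) = extremaNodal n from rfl, extremaNodal_eval hn,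
    nodalWeight_node_eq hn hj]
  have hne : x - node n j ≠ 0 := sub_ne_zero.2 hx
  have hn' : (n : ℝ) ≠ 0 := by exact_mod_cast hn
  have hd := (trapezoidWeight_pos n j).ne'
  field_simp

/-- (1.98): `L_n(f, U; x) = ((1 - x²) T_n'(x)/n²) Σ''_{j=0}^{n} (-1)^{j+1} f(η_j)/(x - η_j)`
`= ((x² - 1) T_n'(x)/n²) Σ_{j=0}^{n} (-1)^j f(η_j) / (trapezoidWeight n j (x - η_j))`, for `x` not a
node (`f` enters through its values `r j = f(η_j)`).
[cite: Rivlin1974, Ex. 1.3.4 (1.60) and Ex. 1.5.7 (1.98)-(1.99)] -/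
theorem eval_interpolate_node_eq {n : ℕ} (hn : n ≠ 0) (r : ℕ → ℝ) {x : ℝ}
    (hx : ∀ j ≤ n, x ≠ node n j) :
    (Lagrange.interpolate (range (n + 1)) (node n) r).eval x =
      (x ^ 2 - 1) * (derivative (T ℝ n)).eval x / (n : ℝ) ^ 2 *
        ∑ j ∈ range (n + 1), (-1) ^ j * r j / (trapezoidWeight n j * (x - node n j)) := by
  rw [Lagrange.interpolate_apply, eval_finsetSum, mul_sum]
  refine sum_congr rfl fun j hj => ?_
  have hj' := Nat.lt_succ_iff.1 (mem_range.1 hj)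
  rw [eval_mul, eval_C, eval_basis_node hn hj' (hx j hj')]
  have hne : x - node n j ≠ 0 := sub_ne_zero.2 (hx j hj')
  have hn' : (n : ℝ) ≠ 0 := by exact_mod_cast hn
  have hd := (trapezoidWeight_pos n j).ne'
  field_simp

/-- Every `p ∈ 𝒫_n` is its own interpolant at the `n + 1` extrema: `p = L_n(p, U; ·)`.
[cite: Rivlin1974, Sect. 1.3 (1.27) and Ex. 1.5.8 (hint)] -/
theorem eq_interpolate_node {n : ℕ} (p : ℝ[X]) (hp : p.natDegree ≤ n) :
    p = Lagrange.interpolate (range (n + 1)) (node n) (fun j => p.eval (node n j)) :=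
  Lagrange.eq_interpolate (injOn_node n)
    (by
      rw [card_range]
      exact (degree_le_of_natDegree_le hp).trans_lt (by exact_mod_cast n.lt_succ_self))

/-- (1.98) for `f = p ∈ 𝒫_n`:
`p(x) = ((x² - 1) T_n'(x)/n²) Σ_{j=0}^{n} (-1)^j p(η_j) / (trapezoidWeight n j (x - η_j))`,
`x` not a node. [cite: Rivlin1974, Ex. 1.5.7 (1.98)] -/
theorem eval_eq_sum_node {n : ℕ} (hn : n ≠ 0) (p : ℝ[X]) (hp : p.natDegree ≤ n) {x : ℝ}
    (hx : ∀ j ≤ n, x ≠ node n j) :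
    p.eval x = (x ^ 2 - 1) * (derivative (T ℝ n)).eval x / (n : ℝ) ^ 2 *
      ∑ j ∈ range (n + 1),
        (-1) ^ j * p.eval (node n j) / (trapezoidWeight n j * (x - node n j)) := by
  conv_lhs => rw [eq_interpolate_node p hp]
  exact eval_interpolate_node_eq hn _ hx

/-! ## At the zeros of `T_n` -/

/-- A zero of `T_n` lies in `(-1, 1)`. [cite: Rivlin1974, Sect. 1.2] -/
theorem abs_lt_one_of_T_eval_eq_zero {n : ℕ} {ξ : ℝ} (hξ : (T ℝ n).eval ξ = 0) : |ξ| < 1 := by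
  by_contra h
  rw [not_lt] at h
  have := one_le_abs_eval_T_real (n : ℤ) h
  rw [hξ, abs_zero] at this
  exact absurd this (by norm_num)

/-- `T_0 = 1` has no zeros. [cite: Rivlin1974, Sect. 1.2] -/
theorem ne_zero_of_T_eval_eq_zero {n : ℕ} {ξ : ℝ} (hξ : (T ℝ n).eval ξ = 0) : n ≠ 0 := by
  rintro rfl
  simp at hξ

/-- A zero of `T_n` is none of the extrema `η_j`. [cite: Rivlin1974, Sect. 1.2] -/
theorem ne_node_of_T_eval_eq_zero {n : ℕ} {ξ : ℝ} (hξ : (T ℝ n).eval ξ = 0) (j : ℕ) :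
    ξ ≠ node n j := by
  intro h
  have hn := ne_zero_of_T_eval_eq_zero hξ
  rw [h, T_eval_node hn] at hξ
  exact pow_ne_zero _ (by norm_num) hξ

/-- At a zero `ξ` of `T_n`: `(1 - ξ²) T_n'(ξ)² = n²` (from `T_n'(cos θ) sin θ = n sin nθ` and
`cos nθ = 0`). [cite: Rivlin1974, Ex. 1.5.8 (1.100)] -/
theorem one_sub_sq_mul_derivative_T_eval_sq {n : ℕ} {ξ : ℝ} (hξ : (T ℝ n).eval ξ = 0) :
    (1 - ξ ^ 2) * ((derivative (T ℝ n)).eval ξ) ^ 2 = (n : ℝ) ^ 2 := by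
  have hlt := abs_lt.1 (abs_lt_one_of_T_eval_eq_zero hξ)
  set θ := Real.arccos ξ with hθ
  have hξθ : Real.cos θ = ξ := Real.cos_arccos hlt.1.le hlt.2.le
  have hsin : Real.sin θ ^ 2 = 1 - ξ ^ 2 := by rw [Real.sin_sq, hξθ]
  have hcos : Real.cos (n * θ) = 0 := by
    have := T_real_cos θ (n : ℤ)
    rw [hξθ, hξ] at this
    exact_mod_cast this.symm
  have hsin_n : Real.sin (n * θ) ^ 2 = 1 := by nlinarith [Real.sin_sq_add_cos_sq (n * θ)]
  have hU := U_real_cos θ ((n : ℤ) - 1)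
  have hder : (derivative (T ℝ n)).eval ξ * Real.sin θ = n * Real.sin (n * θ) := by
    rw [T_derivative_eq_U, eval_mul, eval_intCast, ← hξθ, mul_assoc, hU]
    push_cast
    ring_nf
  calc (1 - ξ ^ 2) * ((derivative (T ℝ n)).eval ξ) ^ 2
      = ((derivative (T ℝ n)).eval ξ * Real.sin θ) ^ 2 := by rw [← hsin]; ring
    _ = (n : ℝ) ^ 2 := by rw [hder, mul_pow, hsin_n, mul_one]

/-- Zeros of `T_n` are simple: `T_n'(ξ) ≠ 0`. [cite: Rivlin1974, Sect. 1.2] -/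
theorem derivative_T_eval_ne_zero_of_T_eval_eq_zero {n : ℕ} {ξ : ℝ} (hξ : (T ℝ n).eval ξ = 0) :
    (derivative (T ℝ n)).eval ξ ≠ 0 := by
  intro h
  have hn := ne_zero_of_T_eval_eq_zero hξ
  have := one_sub_sq_mul_derivative_T_eval_sq hξ
  rw [h] at this
  have : (n : ℝ) = 0 := by nlinarith
  exact hn (by exact_mod_cast this)

/-- `|T_n'(ξ)| = n (1 - ξ²)^{-1/2}` at a zero `ξ` of `T_n`. [cite: Rivlin1974, Ex. 1.5.8 (1.100)] -/
theorem abs_derivative_T_eval_eq_of_T_eval_eq_zero {n : ℕ} {ξ : ℝ} (hξ : (T ℝ n).eval ξ = 0) :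
    |(derivative (T ℝ n)).eval ξ| = n / Real.sqrt (1 - ξ ^ 2) := by
  have hlt := abs_lt.1 (abs_lt_one_of_T_eval_eq_zero hξ)
  have hpos : 0 < 1 - ξ ^ 2 := by nlinarith
  have h := one_sub_sq_mul_derivative_T_eval_sq hξ
  rw [eq_div_iff (Real.sqrt_pos.2 hpos).ne']
  have hsq : (|(derivative (T ℝ n)).eval ξ| * Real.sqrt (1 - ξ ^ 2)) ^ 2 = ((n : ℝ)) ^ 2 := by
    rw [mul_pow, sq_abs, Real.sq_sqrt hpos.le, ← h]; ring
  exact (pow_left_inj₀ (by positivity) (Nat.cast_nonneg n) two_ne_zero).1 hsq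

/-- DIFFERENTIATED FUNDAMENTAL POLYNOMIALS AT A ZERO OF `T_n`:
`l_j'(ξ) = (-1)^j T_n'(ξ) (1 - ξ η_j) / (n² · trapezoidWeight n j · (ξ - η_j)²)`; in particular
`sgn l_j'(ξ) = (-1)^j sgn T_n'(ξ)` for every `j` (the heart of Ex. 1.5.8).
[cite: Rivlin1974, Ex. 1.5.8 (1.100), hint] -/
theorem derivative_basis_eval_of_T_eval_eq_zero {n j : ℕ} (hj : j ≤ n) {ξ : ℝ}
    (hξ : (T ℝ n).eval ξ = 0) :
    (derivative (Lagrange.basis (range (n + 1)) (node n) j)).eval ξ =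
      (-1) ^ j * (derivative (T ℝ n)).eval ξ * (1 - ξ * node n j) /
        ((n : ℝ) ^ 2 * trapezoidWeight n j * (ξ - node n j) ^ 2) := by
  have hn := ne_zero_of_T_eval_eq_zero hξ
  have hn' : (n : ℝ) ≠ 0 := by exact_mod_cast hn
  have hjs : j ∈ range (n + 1) := mem_range.2 (Nat.lt_succ_of_le hj)
  set Wj := Lagrange.nodal ((range (n + 1)).erase j) (node n) with hWj
  have hb : Lagrange.basis (range (n + 1)) (node n) j =
      C (Lagrange.nodalWeight (range (n + 1)) (node n) j) * Wj := by
    rw [Lagrange.basis_eq_prod_sub_inv_mul_nodal_div hjs, hWj,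
      Lagrange.nodal_erase_eq_nodal_div hjs]
  have hW : extremaNodal n = (X - C (node n j)) * Wj := Lagrange.nodal_eq_mul_nodal_erase hjs
  have e1 : (extremaNodal n).eval ξ = (ξ - node n j) * Wj.eval ξ := by
    rw [hW]; simp [eval_mul]
  have e2 : (derivative (extremaNodal n)).eval ξ =
      Wj.eval ξ + (ξ - node n j) * (derivative Wj).eval ξ := by
    rw [hW, derivative_mul]; simp [eval_mul]
  have hne : ξ - node n j ≠ 0 := sub_ne_zero.2 (ne_node_of_T_eval_eq_zero hξ j)
  have v1 := extremaNodal_eval hn ξ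
  have v2 : (derivative (extremaNodal n)).eval ξ =
      ξ * (derivative (T ℝ n)).eval ξ / ((n : ℝ) * 2 ^ (n - 1)) := by
    rw [derivative_extremaNodal_eq hn]
    simp [eval_mul, hξ]
    ring
  have h3 : (derivative Wj).eval ξ * (ξ - node n j) ^ 2 =
      (ξ - node n j) * (derivative (extremaNodal n)).eval ξ - (extremaNodal n).eval ξ := by
    rw [e1, e2]; ring
  have key : (derivative Wj).eval ξ =
      (derivative (T ℝ n)).eval ξ * (1 - ξ * node n j) /
        ((ξ - node n j) ^ 2 * ((n : ℝ) * 2 ^ (n - 1))) := by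
    rw [eq_div_iff (by positivity), ← mul_assoc, h3, v1, v2]
    field_simp
    ring
  rw [hb, derivative_C_mul, eval_mul, eval_C, nodalWeight_node_eq hn hj, key]
  have hd := (trapezoidWeight_pos n j).ne'
  field_simp

/-- `p'(ξ) = L_n'(p, U; ξ)`
`= (T_n'(ξ)/n²) Σ_{j=0}^{n} (-1)^j p(η_j) (1 - ξη_j) / (trapezoidWeight n j (ξ - η_j)²)`
for `p ∈ 𝒫_n` and `T_n(ξ) = 0`. [cite: Rivlin1974, Ex. 1.5.8 (1.100), hint] -/
theorem derivative_eval_eq_sum_of_T_eval_eq_zero {n : ℕ} (p : ℝ[X]) (hp : p.natDegree ≤ n) {ξ : ℝ}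
    (hξ : (T ℝ n).eval ξ = 0) :
    (derivative p).eval ξ = (derivative (T ℝ n)).eval ξ / (n : ℝ) ^ 2 *
      ∑ j ∈ range (n + 1), (-1) ^ j * p.eval (node n j) * (1 - ξ * node n j) /
        (trapezoidWeight n j * (ξ - node n j) ^ 2) := by
  have hn := ne_zero_of_T_eval_eq_zero hξ
  have hn' : (n : ℝ) ≠ 0 := by exact_mod_cast hn
  conv_lhs => rw [eq_interpolate_node p hp]
  rw [Lagrange.interpolate_apply, derivative_sum, eval_finsetSum, mul_sum]
  refine sum_congr rfl fun j hj => ?_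
  have hj' := Nat.lt_succ_iff.1 (mem_range.1 hj)
  rw [derivative_C_mul, eval_mul, eval_C, derivative_basis_eval_of_T_eval_eq_zero hj' hξ]
  have hd := (trapezoidWeight_pos n j).ne'
  have hne : ξ - node n j ≠ 0 := sub_ne_zero.2 (ne_node_of_T_eval_eq_zero hξ j)
  field_simp

/-- Taking `p = T_n` (`T_n(η_j) = (-1)^j`, `T_n'(ξ) ≠ 0`):
`Σ_{j=0}^{n} (1 - ξη_j) / (trapezoidWeight n j (ξ - η_j)²) = n²` at every zero `ξ` of `T_n`.
[cite: Rivlin1974, Ex. 1.5.8 (1.100), hint] -/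
theorem sum_node_weights_eq_sq {n : ℕ} {ξ : ℝ} (hξ : (T ℝ n).eval ξ = 0) :
    ∑ j ∈ range (n + 1), (1 - ξ * node n j) / (trapezoidWeight n j * (ξ - node n j) ^ 2) =
      (n : ℝ) ^ 2 := by
  have hn := ne_zero_of_T_eval_eq_zero hξ
  have hn' : (n : ℝ) ≠ 0 := by exact_mod_cast hn
  have h := derivative_eval_eq_sum_of_T_eval_eq_zero (T ℝ n)
    (by rw [natDegree_T, Int.natAbs_natCast]) hξ
  have hS : ∑ j ∈ range (n + 1), (-1 : ℝ) ^ j * (T ℝ n).eval (node n j) * (1 - ξ * node n j) /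
      (trapezoidWeight n j * (ξ - node n j) ^ 2) =
      ∑ j ∈ range (n + 1),
        (1 - ξ * node n j) / (trapezoidWeight n j * (ξ - node n j) ^ 2) := by
    refine sum_congr rfl fun j _ => ?_
    rw [T_eval_node hn, ← pow_add, ← two_mul, pow_mul, neg_one_sq, one_pow, one_mul]
  rw [hS] at h
  have hT := derivative_T_eval_ne_zero_of_T_eval_eq_zero hξ
  rw [div_mul_eq_mul_div, eq_div_iff (pow_ne_zero 2 hn')] at h
  exact (mul_left_cancel₀ hT h).symm

/-- Each weight `(1 - ξη_j) / (trapezoidWeight n j (ξ - η_j)²)` is nonnegative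
(`|ξ| < 1`, `|η_j| ≤ 1`).
[cite: Rivlin1974, Ex. 1.5.8 (1.100)] -/
theorem node_weight_nonneg {n : ℕ} {ξ : ℝ} (hξ : (T ℝ n).eval ξ = 0) (j : ℕ) :
    0 ≤ (1 - ξ * node n j) / (trapezoidWeight n j * (ξ - node n j) ^ 2) := by
  have h1 : ξ * node n j ≤ 1 := by
    have := abs_lt_one_of_T_eval_eq_zero hξ
    have h := abs_node_le_one n j
    calc ξ * node n j ≤ |ξ * node n j| := le_abs_self _
      _ = |ξ| * |node n j| := abs_mul _ _
      _ ≤ 1 * 1 := mul_le_mul this.le h (abs_nonneg _) zero_le_one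
      _ = 1 := one_mul _
  have := trapezoidWeight_pos n j
  apply div_nonneg (by linarith) (by positivity)

/-! ## (1.100) Duffin–Schaeffer -/

/-- DUFFIN–SCHAEFFER (Rivlin Ex. 1.5.8, (1.100)): if `p ∈ 𝒫_n` and `|p(η_j)| ≤ 1` for
`j = 0, …, n`, then `|p'(ξ)| ≤ |T_n'(ξ)|` at every zero `ξ` of `T_n`.
[cite: Rivlin1974, Ex. 1.5.8 (1.100)] -/
theorem duffinSchaeffer_abs_derivative_eval_le {n : ℕ} (p : ℝ[X]) (hp : p.natDegree ≤ n)
    (hb : ∀ j ≤ n, |p.eval (node n j)| ≤ 1) {ξ : ℝ} (hξ : (T ℝ n).eval ξ = 0) :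
    |(derivative p).eval ξ| ≤ |(derivative (T ℝ n)).eval ξ| := by
  have hn := ne_zero_of_T_eval_eq_zero hξ
  have hn' : (0 : ℝ) < n := by exact_mod_cast Nat.pos_of_ne_zero hn
  rw [derivative_eval_eq_sum_of_T_eval_eq_zero p hp hξ, abs_mul, abs_div, abs_pow, Nat.abs_cast]
  have hterm : ∀ j ∈ range (n + 1),
      |(-1 : ℝ) ^ j * p.eval (node n j) * (1 - ξ * node n j) /
        (trapezoidWeight n j * (ξ - node n j) ^ 2)| ≤
        (1 - ξ * node n j) / (trapezoidWeight n j * (ξ - node n j) ^ 2) := by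
    intro j hj
    have hj' := Nat.lt_succ_iff.1 (mem_range.1 hj)
    have hw := node_weight_nonneg hξ j
    rw [show (-1 : ℝ) ^ j * p.eval (node n j) * (1 - ξ * node n j) /
        (trapezoidWeight n j * (ξ - node n j) ^ 2) = (-1 : ℝ) ^ j * p.eval (node n j) *
        ((1 - ξ * node n j) / (trapezoidWeight n j * (ξ - node n j) ^ 2)) by ring,
      abs_mul, abs_mul, abs_pow, abs_neg, abs_one, one_pow, one_mul, abs_of_nonneg hw]
    exact mul_le_of_le_one_left hw (hb j hj')
  calc |(derivative (T ℝ n)).eval ξ| / (n : ℝ) ^ 2 *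
        |∑ j ∈ range (n + 1), (-1 : ℝ) ^ j * p.eval (node n j) * (1 - ξ * node n j) /
          (trapezoidWeight n j * (ξ - node n j) ^ 2)|
      ≤ |(derivative (T ℝ n)).eval ξ| / (n : ℝ) ^ 2 *
        ∑ j ∈ range (n + 1),
          (1 - ξ * node n j) / (trapezoidWeight n j * (ξ - node n j) ^ 2) :=
        mul_le_mul_of_nonneg_left ((abs_sum_le_sum_abs _ _).trans (sum_le_sum hterm))
          (by positivity)
    _ = |(derivative (T ℝ n)).eval ξ| := by
        rw [sum_node_weights_eq_sq hξ]
        field_simp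

/-- DUFFIN–SCHAEFFER, explicit bound: `|p'(ξ)| ≤ n (1 - ξ²)^{-1/2}` at every zero `ξ` of `T_n`,
for `p ∈ 𝒫_n` with `|p(η_j)| ≤ 1`, `j = 0, …, n`. [cite: Rivlin1974, Ex. 1.5.8 (1.100)] -/
theorem duffinSchaeffer_abs_derivative_eval_le_div_sqrt {n : ℕ} (p : ℝ[X]) (hp : p.natDegree ≤ n)
    (hb : ∀ j ≤ n, |p.eval (node n j)| ≤ 1) {ξ : ℝ} (hξ : (T ℝ n).eval ξ = 0) :
    |(derivative p).eval ξ| ≤ n / Real.sqrt (1 - ξ ^ 2) := by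
  rw [← abs_derivative_T_eval_eq_of_T_eval_eq_zero hξ]
  exact duffinSchaeffer_abs_derivative_eval_le p hp hb hξ

/-- `T_n` vanishes at `ξ_j = cos((2j+1)π/(2n))` (0-based indexing of the text's `ξ_j^{(n)}`).
[cite: Rivlin1974, Sect. 1.2] -/
theorem T_eval_cos_chebyshevZero {n : ℕ} (hn : n ≠ 0) (j : ℕ) :
    (T ℝ n).eval (Real.cos ((2 * j + 1) * π / (2 * n))) = 0 := by
  rw [T_real_cos]
  have hn' : (n : ℝ) ≠ 0 := by exact_mod_cast hn
  push_cast
  rw [show (n : ℝ) * ((2 * j + 1) * π / (2 * n)) = (2 * (j : ℤ) + 1) * π / 2 by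
    push_cast; field_simp]
  exact Real.cos_eq_zero_iff.2 ⟨j, rfl⟩

/-- DUFFIN–SCHAEFFER at the text's nodes: for `p ∈ 𝒫_n` with `|p(η_j^{(n)})| ≤ 1` (`j = 0, …, n`)
and `ξ_j = cos((2j+1)π/(2n))`, `|p'(ξ_j)| ≤ |T_n'(ξ_j)| = n (1 - ξ_j²)^{-1/2}`.
[cite: Rivlin1974, Ex. 1.5.8 (1.100)] -/
theorem duffinSchaeffer_at_cos {n : ℕ} (hn : n ≠ 0) (p : ℝ[X]) (hp : p.natDegree ≤ n)
    (hb : ∀ j ≤ n, |p.eval (node n j)| ≤ 1) (j : ℕ) :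
    |(derivative p).eval (Real.cos ((2 * j + 1) * π / (2 * n)))| ≤
        |(derivative (T ℝ n)).eval (Real.cos ((2 * j + 1) * π / (2 * n)))| ∧
      |(derivative (T ℝ n)).eval (Real.cos ((2 * j + 1) * π / (2 * n)))| =
        n / Real.sqrt (1 - Real.cos ((2 * j + 1) * π / (2 * n)) ^ 2) :=
  ⟨duffinSchaeffer_abs_derivative_eval_le p hp hb (T_eval_cos_chebyshevZero hn j),
    abs_derivative_T_eval_eq_of_T_eval_eq_zero (T_eval_cos_chebyshevZero hn j)⟩

end Literature.Analysis.Approximation.ChebyshevExtremaInterpolation
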